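import Summits.FinalStateConjecture.FinalStateConjecture.Theorems.NearExtremalKappaCapture.Negative.ExtremalGerm
import Summits.FinalStateConjecture.FinalStateConjecture.Theorems.PhaseMixingCaptureNearExtremalKappaCaptureFarCompleteTransport
import Literature.Geometry.Lorentzian.KerrStabilitySubextremalCauchy

/-!
# Strength bracket of the crux `NearExtremalKappaCapture` (stmt-FinalStateConjecture-10606, route PhaseMixingCapture)
# — crux-strategist r1 certificate (second opinion on the p1 census `no-strategy-short-of-summit`)

Sorry-free bookkeeping over landed files (`Negative.ExtremalGerm` p77058, `…FarCompleteTransport` p102813,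
`Literature.Geometry.Lorentzian.KerrStabilitySubextremalCauchy` p78222 / wi-30700). Nothing here closes the
crux. What it certifies, for the tribunal, is WHERE the crux sits between two named statements of the
literature, in the tree's own vocabulary and with kernel-checked edges:

  `NearExtremalKerrStability`            ⇐  `NearExtremalKappaCapture`  ⇐  `NearExtremalLipschitzCapture`
  (Kerr stability conjecture, Cauchy         (the crux, rank 2)             (AKU arXiv:2603.10378 Conj. 1
   consequence form, POINTWISE in the                                        "universality of the Kerr(–Newman)
   centre, on the near-extremal spins                                        family" on a uniform neighbourhood
   `a₁M ≤ |a| < M`; = the shape of                                           of the extremal threshold, read with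
   Dafermos–Rodnianski arXiv:0811.0354                                       a Lipschitz final-parameter map;
   Conj. 5.1 / Dafermos–Luk arXiv:1710.01722                                 conjecture grade, unproved in vacuum
   Conj. 1 over the repaired MGHD notion,                                    outside symmetry)
   and LITERALLY the conclusion shape of the
   vendored claim `hintz_kerr_stability_subextremal_cauchy.pointwise`
   at the unit leaf `r₀ = M`, with the b-conormality side
   condition of Hintz's data class dropped — i.e. for the
   larger bare `H^s_δ`-ball class)

* `pointwise_of_captureWith`, `kerrStability_of_near` (LOWER edge): a κ-explicit basin `c χ^γ` and modulus
  `C χ^{-p} √dist` give, spin by spin, a plain basin `ε(M, a, η) > 0` with final parameters within any `η`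
  (take `ε = min (c χ^γ) ((η / K)²)`, `K = max C 0 · χ^{-p} + 1`). So the crux contains the Kerr stability
  conjecture for EVERY near-extremal spin (bare-ball data, every MGHD, far-complete `𝓘⁺`, `C^k` convergence,
  sub-extremal end state, `∀ η ∃ ε` nearness) — before Hintz's 2026 claim an open problem at each single such
  spin, and as of 2026-08 covered in print only by that unrefereed claim (for b-conormal data) and by no
  refereed theorem (Klainerman–Szeftel / GKS: `|a| ≪ M`).
* `hintzPointwiseShape_of_near` / `hintzPointwiseShape_of_claim`: the crux's spin-by-spin consequence and the
  vendored claim's pointwise form at `r₀ = M` are the SAME Lean proposition body (the second is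
  `hintz_kerr_stability_subextremal_cauchy.pointwise` at the unit leaf, `Kerr.unitLeaf_admissible`), so the
  comparison "crux ≥ Hintz-shape on `[a₁M, M)`" is literal, not a paraphrase.
* `near_of_lipschitzCapture` (UPPER edge, = door K1 of the p1 census, re-homed here so that both edges live in
  one landed file): Lipschitz capture at the geometric basin order `γ = 1` implies the crux at
  `(γ, p) = (1, −1/2)` (`Negative.captureWith_of_linear`).
* `strength_bracket`: the two edges packaged.

Reading (STRATEGY-CENSUS-r1.md §0): the crux is the RATE statement sandwiched strictly between the
qualitative Kerr stability conjecture on the near-extremal range (necessary) and the uniform/Lipschitz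
AKU-type statement (sufficient); by `Negative.near_iff_germ` it is, granted bulk capture, exactly the
assertion that Hintz's basin degenerates at worst polynomially in `χ = 1 − a²/M²`. No printed theorem sits
between the two brackets with a rate (searches logged in the census, corpus + galaxy).
-/

noncomputable section

set_option linter.dupNamespace false

namespace Summit.FinalStateConjecture.FinalStateConjecture.Theorems.NearExtremalKappaCapture.Strength

open Summit.FinalStateConjecture.FinalStateConjecture.Theses.PhaseMixingCapture
open Summit.FinalStateConjecture.FinalStateConjecture.Theorems.NearExtremalKappaCapture.Negative
open Summit.FinalStateConjecture.FinalStateConjecture.Theorems.NearExtremalKappaCapture.AreaExcessRatchet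
open Literature.Geometry.Lorentzian
open scoped Manifold ContDiff Topology ENNReal
open Set Filter

/-! ## §1  The lower bracket: the Kerr stability conjecture on the near-extremal range -/

/-- **Kerr stability conjecture, Cauchy consequence form, pointwise in the centre, on the near-extremal
spins.** There are `a₁ < 1` and exponents `(s, δ, k)` such that for every `M > 0`, every spin
`a₁M ≤ |a| < M` and every tolerance `η > 0` some basin radius `ε > 0` serves all vacuum data `D` on the
unit Kerr–Schild leaf `Kerr.slice a M` within `H^s_δ`-distance `ε` of `Kerr.data M a M`: every maximal vacuum
Cauchy development has sojourn-complete far `𝓘⁺` (`HasCompleteFutureNullInfinityFar`), a region converging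
in `C^k` to a SUB-extremal Kerr exterior `g_{M',a'}`, and `|M' − M| + |a' − a| ≤ η`. This is the shape of
Dafermos–Rodnianski arXiv:0811.0354 Conj. 5.1 / Dafermos–Luk arXiv:1710.01722 Conj. 1 over the repaired MGHD
notion (`VacuumCauchyDevelopment`, not the uninhabited `VacuumDevelopment` of gr.S04), restricted to
near-extremal spins; spin by spin it is literally the conclusion of
`hintz_kerr_stability_subextremal_cauchy.pointwise` at `r₀ = M` for the larger bare-ball data class
(`hintzPointwiseShape_of_near` below). -/
def NearExtremalKerrStability [Kerr.Facts] [Kerr.SliceFacts] : Prop :=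
  ∃ a₁ : ℝ, a₁ < 1 ∧ ∃ (s : ℕ) (δ : ℝ) (k : ℕ), ∀ (M : ℝ) (hM : 0 < M) (a : ℝ), a₁ * M ≤ |a| →
    Kerr.IsSubextremal M a → ∀ η > (0 : ℝ), ∃ ε > (0 : ℝ),
      ∀ (D : InitialDataSet 𝓘(ℝ, E3) (Kerr.slice a M)) [D.metric.HasLeviCivita],
        D.IsVacuumConstraintSolution →
          InitialDataSet.dataWeightedSobolevEDist s δ D (Kerr.data M a M hM.le) <
              ENNReal.ofReal ε →
            ∀ 𝒟 : VacuumCauchyDevelopment D, 𝒟.IsMaximal →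
              ∃ (M' a' : ℝ) (𝒟oc : Set 𝒟.carrier), Kerr.IsSubextremal M' a' ∧
                |M' - M| + |a' - a| ≤ η ∧ 𝒟.HasCompleteFutureNullInfinityFar ∧
                  𝒟.toSpacetime.ConvergesToKerr 𝒟oc M' a' k

/-- **κ-capture ⇒ plain pointwise capture with prescribed nearness.** From `CaptureWith s δ k γ p a₁`
(basin `c χ^γ`, modulus `C χ^{-p} √dist`, `χ = 1 − (a/M)²`), at every spin `a₁M ≤ |a| < M` and for every
`η > 0` the basin `ε := min (c χ^γ) ((η / K)²)`, `K := max C 0 · χ^{-p} + 1 > 0`, yields far-complete MGHDs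
`C^k`-converging to a sub-extremal Kerr with `|M' − M| + |a' − a| ≤ K √dist ≤ η`. Elementary. -/
theorem pointwise_of_captureWith [Kerr.Facts] [Kerr.SliceFacts] {s : ℕ} {δ : ℝ} {k : ℕ} {γ p a₁ : ℝ}
    (h : CaptureWith s δ k γ p a₁) {M : ℝ} (hM : 0 < M) {a : ℝ} (ha : a₁ * M ≤ |a|)
    (hsub : Kerr.IsSubextremal M a) {η : ℝ} (hη : 0 < η) :
    ∃ ε > (0 : ℝ), ∀ (D : InitialDataSet 𝓘(ℝ, E3) (Kerr.slice a M)) [D.metric.HasLeviCivita],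
      D.IsVacuumConstraintSolution →
        InitialDataSet.dataWeightedSobolevEDist s δ D (Kerr.data M a M hM.le) < ENNReal.ofReal ε →
          ∀ 𝒟 : VacuumCauchyDevelopment D, 𝒟.IsMaximal →
            ∃ (M' a' : ℝ) (𝒟oc : Set 𝒟.carrier), Kerr.IsSubextremal M' a' ∧
              |M' - M| + |a' - a| ≤ η ∧ FarComplete 𝒟 ∧
                𝒟.toSpacetime.ConvergesToKerr 𝒟oc M' a' k := by
  obtain ⟨c, hc, C, h⟩ := h M hM
  obtain ⟨hx0, -⟩ := kappaSq_pos_le_one hsub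
  have hpow0 : 0 ≤ (1 - (a / M) ^ 2) ^ (-p) := Real.rpow_nonneg hx0.le _
  have hC0 : 0 ≤ max C 0 := le_max_right _ _
  have hK : 0 < max C 0 * (1 - (a / M) ^ 2) ^ (-p) + 1 :=
    lt_of_lt_of_le one_pos (le_add_of_nonneg_left (mul_nonneg hC0 hpow0))
  have hηK : 0 < η / (max C 0 * (1 - (a / M) ^ 2) ^ (-p) + 1) := div_pos hη hK
  refine ⟨min (c * (1 - (a / M) ^ 2) ^ γ) ((η / (max C 0 * (1 - (a / M) ^ 2) ^ (-p) + 1)) ^ 2),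
    lt_min (mul_pos hc (Real.rpow_pos_of_pos hx0 γ)) (pow_pos hηK 2),
    fun D _ hvac hdist 𝒟 hmax ↦ ?_⟩
  have hdist' : InitialDataSet.dataWeightedSobolevEDist s δ D (Kerr.data M a M hM.le) <
      ENNReal.ofReal (c * (1 - (a / M) ^ 2) ^ γ) :=
    hdist.trans_le (ENNReal.ofReal_le_ofReal (min_le_left _ _))
  obtain ⟨M', a', 𝒟oc, hsub', hfar, hconv, hmod⟩ := h a ha hsub D hvac hdist' 𝒟 hmax
  refine ⟨M', a', 𝒟oc, hsub', ?_, hfar, hconv⟩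
  set d : ℝ := (InitialDataSet.dataWeightedSobolevEDist s δ D (Kerr.data M a M hM.le)).toReal
    with hddef
  have hdlt : d < (η / (max C 0 * (1 - (a / M) ^ 2) ^ (-p) + 1)) ^ 2 :=
    (ENNReal.toReal_lt_of_lt_ofReal hdist).trans_le (min_le_right _ _)
  have hsqrt : √d ≤ η / (max C 0 * (1 - (a / M) ^ 2) ^ (-p) + 1) :=
    calc √d ≤ √((η / (max C 0 * (1 - (a / M) ^ 2) ^ (-p) + 1)) ^ 2) := Real.sqrt_le_sqrt hdlt.le
      _ = η / (max C 0 * (1 - (a / M) ^ 2) ^ (-p) + 1) := Real.sqrt_sq hηK.le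
  have hd : 0 ≤ √d := Real.sqrt_nonneg _
  calc |M' - M| + |a' - a| ≤ C * (1 - (a / M) ^ 2) ^ (-p) * √d := hmod
    _ ≤ max C 0 * (1 - (a / M) ^ 2) ^ (-p) * √d :=
        mul_le_mul_of_nonneg_right (mul_le_mul_of_nonneg_right (le_max_left _ _) hpow0) hd
    _ ≤ (max C 0 * (1 - (a / M) ^ 2) ^ (-p) + 1) * √d :=
        mul_le_mul_of_nonneg_right (le_add_of_nonneg_right zero_le_one) hd
    _ ≤ (max C 0 * (1 - (a / M) ^ 2) ^ (-p) + 1) *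
          (η / (max C 0 * (1 - (a / M) ^ 2) ^ (-p) + 1)) :=
        mul_le_mul_of_nonneg_left hsqrt hK.le
    _ = η := mul_div_cancel₀ η hK.ne'

/-- **LOWER EDGE: the crux implies the Kerr stability conjecture on the near-extremal range** (Cauchy
consequence form, pointwise in the centre, unit leaf, bare `H^s_δ` ball, every MGHD). The far-completeness
clause of the crux is the tree's `HasCompleteFutureNullInfinityFar`
(`AreaExcessRatchet.farComplete_iff_hasCompleteFutureNullInfinityFar`, p102813). -/
theorem kerrStability_of_near [hF : Kerr.Facts] [hS : Kerr.SliceFacts] (hN : NearExtremalKappaCapture) :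
    NearExtremalKerrStability := by
  obtain ⟨s, δ, k, γ, p, a₁, ha₁, hcap⟩ := near_iff.mp hN
  refine ⟨a₁, ha₁, s, δ, k, fun M hM a ha hsub η hη ↦ ?_⟩
  obtain ⟨ε, hε, H⟩ := pointwise_of_captureWith hcap hM ha hsub hη
  refine ⟨ε, hε, fun D _ hvac hdist 𝒟 hmax ↦ ?_⟩
  obtain ⟨M', a', 𝒟oc, hsub', hmod, hfar, hconv⟩ := H D hvac hdist 𝒟 hmax
  exact ⟨M', a', 𝒟oc, hsub', hmod, (farComplete_iff_hasCompleteFutureNullInfinityFar 𝒟).mp hfar,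
    hconv⟩

/-- **The crux's spin-by-spin consequence has LITERALLY the shape of the vendored Hintz claim at the unit
leaf.** For every near-extremal spin, the crux yields the body of
`hintz_kerr_stability_subextremal_cauchy.pointwise M a hM ha (unit leaf)` — including its (here unused)
b-conormality hypothesis `∀ s', dist_{s',δ} < ⊤` — so "crux ≥ Hintz 2026 Thm 13.1 (consequence form) on
`[a₁M, M)`" is a statement about identical Lean propositions (compare `hintzPointwiseShape_of_claim`). -/
theorem hintzPointwiseShape_of_near [hF : Kerr.Facts] [hS : Kerr.SliceFacts]
    (hN : NearExtremalKappaCapture) :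
    ∃ a₁ : ℝ, a₁ < 1 ∧ ∀ (M a : ℝ) (hM : 0 < M), a₁ * M ≤ |a| → Kerr.IsSubextremal M a →
      ∃ (s : ℕ) (δ : ℝ) (k : ℕ), ∀ η > (0 : ℝ), ∃ ε > (0 : ℝ),
        ∀ (D : InitialDataSet 𝓘(ℝ, E3) (Kerr.slice a M)) [D.metric.HasLeviCivita],
          D.IsVacuumConstraintSolution →
          (∀ s' : ℕ,
            InitialDataSet.dataWeightedSobolevEDist s' δ D (Kerr.data M a M hM.le) < ⊤) →
          InitialDataSet.dataWeightedSobolevEDist s δ D (Kerr.data M a M hM.le) <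
            ENNReal.ofReal ε →
          ∀ 𝒟 : VacuumCauchyDevelopment D, 𝒟.IsMaximal →
            ∃ (M' a' : ℝ) (𝒟oc : Set 𝒟.carrier), Kerr.IsSubextremal M' a' ∧
              |M' - M| + |a' - a| ≤ η ∧
              𝒟.HasCompleteFutureNullInfinityFar ∧
              𝒟.toSpacetime.ConvergesToKerr 𝒟oc M' a' k := by
  obtain ⟨a₁, ha₁, s, δ, k, H⟩ := kerrStability_of_near hN
  refine ⟨a₁, ha₁, fun M a hM ha hsub ↦ ⟨s, δ, k, fun η hη ↦ ?_⟩⟩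
  obtain ⟨ε, hε, Hε⟩ := H M hM a ha hsub η hη
  exact ⟨ε, hε, fun D _ hvac _ hdist 𝒟 hmax ↦ Hε D hvac hdist 𝒟 hmax⟩

/-- **The same proposition body, obtained from the vendored claim** (sanity / literalness check): for EVERY
sub-extremal spin, `hintz_kerr_stability_subextremal_cauchy.pointwise` at the unit leaf `r₀ = M`
(`Kerr.unitLeaf_admissible`) is word for word the per-spin body of `hintzPointwiseShape_of_near`. Hintz,
arXiv:2606.28253, Thm. 13.1 with Remark 13.2 (claim, under review). -/
theorem hintzPointwiseShape_of_claim [Kerr.Facts] [Kerr.SliceFacts]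
    (h : hintz_kerr_stability_subextremal_cauchy) (M a : ℝ) (hM : 0 < M)
    (ha : Kerr.IsSubextremal M a) :
    ∃ (s : ℕ) (δ : ℝ) (k : ℕ), ∀ η > (0 : ℝ), ∃ ε > (0 : ℝ),
      ∀ (D : InitialDataSet 𝓘(ℝ, E3) (Kerr.slice a M)) [D.metric.HasLeviCivita],
        D.IsVacuumConstraintSolution →
        (∀ s' : ℕ,
          InitialDataSet.dataWeightedSobolevEDist s' δ D (Kerr.data M a M hM.le) < ⊤) →
        InitialDataSet.dataWeightedSobolevEDist s δ D (Kerr.data M a M hM.le) <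
          ENNReal.ofReal ε →
        ∀ 𝒟 : VacuumCauchyDevelopment D, 𝒟.IsMaximal →
          ∃ (M' a' : ℝ) (𝒟oc : Set 𝒟.carrier), Kerr.IsSubextremal M' a' ∧
            |M' - M| + |a' - a| ≤ η ∧
            𝒟.HasCompleteFutureNullInfinityFar ∧
            𝒟.toSpacetime.ConvergesToKerr 𝒟oc M' a' k :=
  h.pointwise M a hM ha (Kerr.unitLeaf_admissible.2 M a hM ha)

/-! ## §2  The upper bracket: AKU-type Lipschitz capture (door K1 of the p1 census, re-homed) -/

/-- **Lipschitz capture at the geometric basin order** (conjecture grade; nothing asserted): there are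
`(s, δ, k)` and `a₁ < 1` with `Negative.LinearCaptureWith s δ k 1 a₁` — basin `c χ¹` (the order-one
shrinkage forced in unpinned norms by the truncation / member traps of `Negative.TruncationTraps`,
`Negative.ThresholdTraps`) and a LIPSCHITZ, κ-free final-parameter modulus `C · dist`. This is what
Angelopoulos–Kehle–Unger arXiv:2603.10378, Conj. 1 (p. 12: "Universality of the Kerr–Newman family" on a
uniform neighbourhood `𝔐_nbhd` of the extremal threshold, `C¹` isologous foliation) asserts for vacuum Kerr
once read in the tree's Cauchy vocabulary; it is unproved outside symmetry (their Thm 1: spherically symmetric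
Einstein–Maxwell–scalar field). Verbatim the def of `Cruxes/NearExtremalKappaCapture/StrategistBridge.lean`. -/
def NearExtremalLipschitzCapture : Prop :=
  ∀ [Kerr.Facts] [Kerr.SliceFacts], ∃ (s : ℕ) (δ : ℝ) (k : ℕ) (a₁ : ℝ), a₁ < 1 ∧
    LinearCaptureWith s δ k 1 a₁

/-- **UPPER EDGE: Lipschitz capture implies the crux**, at the exponent vector
`(s, δ, k, γ, p, a₁) = (s, δ, k, 1, −1/2, a₁)` (`Negative.captureWith_of_linear`, p77058). -/
theorem near_of_lipschitzCapture (h : NearExtremalLipschitzCapture) : NearExtremalKappaCapture := by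
  refine near_iff.mpr ?_
  intro hF hS
  obtain ⟨s, δ, k, a₁, ha₁, hlin⟩ := @h hF hS
  exact ⟨s, δ, k, 1, -(1 / 2), a₁, ha₁, captureWith_of_linear hlin⟩

/-! ## §3  The bracket -/

/-- **Strength bracket of the crux.** `NearExtremalLipschitzCapture → NearExtremalKappaCapture` and
`NearExtremalKappaCapture → NearExtremalKerrStability` (under the crux's own instance binders, both
inhabited in the tree: `SwallowTheDatum.kerrFacts`, `Negative.sliceFacts_of`). The crux is the RATE
statement strictly between the qualitative Kerr stability conjecture on the near-extremal range and the
uniform AKU-type statement; cf. `Negative.near_iff_germ` (granted bulk capture it is exactly "the basin of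
the Kerr stability theorem degenerates at worst polynomially in `1 − a²/M²`"). -/
theorem strength_bracket :
    (NearExtremalLipschitzCapture → NearExtremalKappaCapture) ∧
      (NearExtremalKappaCapture → ∀ [Kerr.Facts] [Kerr.SliceFacts], NearExtremalKerrStability) :=
  ⟨near_of_lipschitzCapture, fun h _ _ ↦ kerrStability_of_near h⟩

end Summit.FinalStateConjecture.FinalStateConjecture.Theorems.NearExtremalKappaCapture.Strength

end
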